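import Literature.NumberTheory.EllipticCurves.HasseWeilGoodReductionFrobeniusProofs
import HarnessLib

/-!
# The `j`-invariant of the reduction at a place of good reduction

`Proofs` file (theorems only, no definitions, no named facts), topic `NumberTheory/EllipticCurves`.
For an elliptic curve `E` over a number field `K` (Weierstrass equation `W`) and a finite place `v`
of good reduction, the reduced curve `Ẽ_v = W.reductionAt v` over the residue field `k_v`
(`HasseWeilGoodReductionFrobenius`: Mathlib's `WeierstrassCurve.reduction` of the chosen local
minimal model `W.localMinimalModel v`) has `j`-invariant **the residue class of `j(E)`**:
`j(Ẽ_v) = j(E) mod v`. Silverman, *The Arithmetic of Elliptic Curves*, 2nd ed., VII.§2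
("reduction modulo `π`": `Ẽ` is obtained by reducing the coefficients of a MINIMAL equation) with
Prop. VII.5.1(a) (good reduction ⟺ `v(Δ) = 0` for a minimal equation, so `v(j) ≥ 0` and
`j̃ = c̃₄³/Δ̃` is the reduction of `j = c₄³/Δ`) and Prop. VII.5.5 / its proof ("`j(E)` is
`v`-integral when `E` has potentially good reduction"); the `j`-invariant does not depend on the
chosen minimal equation (III.1.4(b), VII.1.3(b)).

* `WeierstrassCurve.algebraMap_j_localMinimalIntegralModel` — for the `𝒪_v`-integral minimal
  model `M = W.localMinimalIntegralModel v` at a good place (an elliptic curve over `𝒪_v`: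
  `isUnit_Δ_localMinimalIntegralModel`), `j(M) ∈ 𝒪_v` maps to `j(W) ∈ K ⊂ K_v`;
* `WeierstrassCurve.j_reductionAt_eq_residue` — `j(Ẽ_v) = residue (j(M))`;
* `WeierstrassCurve.j_reductionAt_eq_intCast` — **if `j(W) = n ∈ ℤ` then `j(Ẽ_v) = n` in
  `k_v`**; `WeierstrassCurve.j_reductionAt_baseChange_eq_intCast` — the same for the base change
  `W_F` to a number field `F` of a curve `W/ℚ` with `j(W) = n ∈ ℤ` (every CM elliptic curve over
  `ℚ`: the thirteen CM `j`-invariants are integers, Silverman *AT* App. A §3).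

USE (cell `b2b-bsdres`, class X12; unit `b2b-bsdres-lit-bst` gen 10): step **J1** of ROUTE J for the
named fact `deuring_not_hasUnitRootAt_of_hasCM_of_not_cmSplit` (HOME/b2b-bsdres-lit-bst/BST-BCST.md
§14.4): with `SupersingularJInvariantFiniteFieldProofs` (supersingularity of `Ẽ_v` depends only
on `(j̃, p)`) it reduces Deuring's criterion at a place of a number field to curves over `𝔽_p`.

## References

* [SilvermanAEC2009] J. H. Silverman, *The Arithmetic of Elliptic Curves*, 2nd ed. (2009):
  VII.§1 (Prop. 1.3), VII.§2, Prop. VII.5.1(a), Prop. VII.5.5, III.1.4(b).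
* [SilvermanATAEC1994] J. H. Silverman, *Advanced Topics*, GTM 151 (1994), App. A §3.

## Design

`noncomputable section`, `open scoped Classical NumberField`; dot-notation extensions in
`namespace WeierstrassCurve`. The reduced curve's `IsElliptic` instance (needed to write `j`) is
taken as an instance argument (`isElliptic_reductionAt hv` supplies it). Nothing is defined; no
named fact is introduced or used.
-/

noncomputable section

open scoped Classical NumberField

open IsDedekindDomain NumberField

universe u

namespace WeierstrassCurve

open Literature.NumberTheory.EllipticCurves

variable {K : Type u} [Field K] [NumberField K] (W : WeierstrassCurve K)
  (v : HeightOneSpectrum (𝓞 K))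

/-- Equal Weierstrass equations have equal `j`-invariants (transport of the `IsElliptic` instance;
private helper). [folklore] -/
private theorem j_eq_of_eq {R : Type*} [CommRing R] {E E' : WeierstrassCurve R} [E.IsElliptic]
    [E'.IsElliptic] (h : E = E') : E.j = E'.j := by
  subst h
  rfl

variable {W v} in
/-- At a place of good reduction the `𝒪_v`-integral minimal model is an elliptic curve over `𝒪_v`
(unit discriminant: `isUnit_Δ_localMinimalIntegralModel`). Silverman, *AEC*, VII.5.1(a).
[cite: SilvermanAEC2009, Prop. VII.5.1(a)] -/
theorem isElliptic_localMinimalIntegralModel (hv : W.HasGoodReductionAt v) :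
    (W.localMinimalIntegralModel v).IsElliptic :=
  ⟨isUnit_Δ_localMinimalIntegralModel hv⟩

variable {W v} in
/-- **`j` of the integral minimal model is `j(E)`**: for `M = W.localMinimalIntegralModel v` at a
good place, `algebraMap 𝒪_v K_v (j(M)) = algebraMap K K_v (j(W))` — `M ⊗ K_v = C • W_{K_v}` for the
chosen change of variables (`exists_variableChange_eq_localMinimalIntegralModel`) and `j` is
invariant under changes of variables (Silverman, *AEC*, III.1.4(b), VII.1.3(b); Mathlib
`variableChange_j`, `map_j`). [cite: SilvermanAEC2009, Prop. VII.1.3(b) and III.1.4(b)] -/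
theorem algebraMap_j_localMinimalIntegralModel [W.IsElliptic] (hv : W.HasGoodReductionAt v) :
    haveI := isElliptic_localMinimalIntegralModel hv
    algebraMap (v.adicCompletionIntegers K) (v.adicCompletion K) (W.localMinimalIntegralModel v).j =
      algebraMap K (v.adicCompletion K) W.j := by
  haveI := isElliptic_localMinimalIntegralModel hv
  obtain ⟨C, hC⟩ := W.exists_variableChange_eq_localMinimalIntegralModel v
  rw [← map_j (W.localMinimalIntegralModel v)
    (algebraMap (v.adicCompletionIntegers K) (v.adicCompletion K)), ← j_eq_of_eq hC,
    variableChange_j]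
  change (W.map (algebraMap K (v.adicCompletion K))).j = _
  rw [map_j]

variable {W v} in
/-- **`j(Ẽ_v)` is the residue class of `j` of the integral minimal model** (`Ẽ_v` is the
coefficientwise residue of `M`, `reductionAt_eq_map_residue`; Mathlib `map_j`). Silverman, *AEC*,
VII.§2. [cite: SilvermanAEC2009, VII.§2 and Prop. VII.5.1(a)] -/
theorem j_reductionAt_eq_residue [W.IsElliptic] (hv : W.HasGoodReductionAt v)
    [(W.reductionAt v).IsElliptic] :
    haveI := isElliptic_localMinimalIntegralModel hv
    (W.reductionAt v).j =
      IsLocalRing.residue (v.adicCompletionIntegers K) (W.localMinimalIntegralModel v).j := by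
  haveI := isElliptic_localMinimalIntegralModel hv
  rw [← map_j (W.localMinimalIntegralModel v) (IsLocalRing.residue (v.adicCompletionIntegers K))]
  exact j_eq_of_eq (W.reductionAt_eq_map_residue v)

variable {W v} in
/-- **`j(Ẽ_v) = j(E) mod v` for integral `j`**: if `j(W) = n ∈ ℤ` and `v` is a place of good
reduction, then `j(W.reductionAt v) = n` in the residue field `k_v`. Silverman, *AEC*, VII.§2 with
Prop. VII.5.1(a). [cite: SilvermanAEC2009, VII.§2 and Prop. VII.5.1(a)] -/
theorem j_reductionAt_eq_intCast [W.IsElliptic] (hv : W.HasGoodReductionAt v)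
    [(W.reductionAt v).IsElliptic] {n : ℤ} (hj : W.j = n) : (W.reductionAt v).j = n := by
  haveI := isElliptic_localMinimalIntegralModel hv
  have h1 := algebraMap_j_localMinimalIntegralModel hv
  rw [hj, map_intCast,
    ← map_intCast (algebraMap (v.adicCompletionIntegers K) (v.adicCompletion K)) n] at h1
  have h2 : (W.localMinimalIntegralModel v).j = n :=
    IsFractionRing.injective (v.adicCompletionIntegers K) (v.adicCompletion K) h1
  rw [j_reductionAt_eq_residue hv, h2, map_intCast]

/-- **`j` of the reduction of a base change.** For `W/ℚ` elliptic with `j(W) = n ∈ ℤ` (e.g. a CM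
curve), a number field `F`, and a place `w` of `F` at which `W_F` has good reduction:
`j((W_F).reductionAt w) = n` in `k_w`. [cite: SilvermanAEC2009, VII.§2 and Prop. VII.5.1(a)] -/
theorem j_reductionAt_baseChange_eq_intCast (W : WeierstrassCurve ℚ) [W.IsElliptic]
    {F : Type u} [Field F] [NumberField F] (w : HeightOneSpectrum (𝓞 F))
    (hw : (W.baseChange F).HasGoodReductionAt w) [((W.baseChange F).reductionAt w).IsElliptic]
    {n : ℤ} (hj : W.j = n) : ((W.baseChange F).reductionAt w).j = n := by
  refine j_reductionAt_eq_intCast hw ?_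
  change (W.map (algebraMap ℚ F)).j = n
  rw [map_j, hj, map_intCast]

end WeierstrassCurve

end
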